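import Literature.Claims.NS.Fulber2026
import Summits.NavierStokesRegularity.NavierStokesRegularity.Theorems.SoloSalvagePermana2026
import Literature.Analysis.FluidPDE.NSVorticityBKMProofs
import Literature.Analysis.FluidPDE.Wei2016Slice
import Literature.Analysis.FluidPDE.VorticityCalculus
import HarnessLib

/-!
# Solo salvage for claim C148 `Fulber2026` (cell `ns-claims`, D-0090): the TRUE-type binders of the
# composition `Literature.Claims.NS.Fulber2026.claim_of_steps`

Claim C148: Fulber, «Global Regularity of 3D Navier-Stokes via the Alignment Gap Mechanism» (Zenodo
18411774, «Version 3.0 — Complete Proof», 2026); skeleton `Literature.Claims.NS.Fulber2026` (typist-3 g5,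
p524074). Four binders of its composition `claim_of_steps` are classical AS TYPED and are discharged here
(records-grade; the located step of the verdict is untouched and nothing disputed is asserted):

* `step3a_holds : Step3a_EnstrophyEq` — the enstrophy identity «dΩ/dt = 2Ω⟨σ⟩_Ω − ν‖∇ω‖²» (p. 3), which the
  skeleton types BY NAME as the C119 identity `Permana2026.Step_4`; discharged by the tree's
  `Permana2026Salvage.step_4_holds` (salvage-p1 g3) — a one-line alias so that the table of binders is complete.
* `step5_BKM_holds : Step5_BKM` — «From Step 4: ‖ω‖_∞ ≤ M < ∞, so ∫₀ᵀ‖ω‖_∞ dt ≤ MT < ∞ for all T. No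
  singularity can form» (p. 3, Beale–Kato–Majda box): a constant majorant of `‖ω(t)‖_∞` on `[0,T)` makes the
  BKM integral finite (`Permana2026Salvage.step_9_holds`) and the tree's BKM a-priori fact
  `MajdaBertozzi2002_bkmAprioriH3_holds` bounds the `H³` norm on `[0,T)` — no blow-up at `T`.
* `step3c_inference_holds : Step3c_inference` — p. 3 «Using Lemma 5.1 and the standard estimate ⟨λ₁⟩_Ω ≲
  ‖∇ω‖^{3/2}/Ω^{1/2}: dΩ/dt ≤ C(1−δ₀/2)Ω^{1/2}‖∇ω‖^{3/2} − ν‖∇ω‖². Optimizing over ‖∇ω‖: dΩ/dt ≤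
  C′(1−δ₀/2)⁴Ω²/ν³»: GIVEN the identity (3a) and the «standard estimate» (3b, disputed — taken as a hypothesis,
  never asserted), the Riccati display (3c) follows with `C′ = 27C⁴/16` by Young's inequality in the polynomial
  form `A s³ − ν s⁴ ≤ 27A⁴/(256ν³)` (`s = ‖∇ω‖₂^{1/2}`; `256ν⁴s⁴ − 256Aν³s³ + 27A⁴ = (4νs − 3A)²(16ν²s² +
  8Aνs + 3A²)`). The irrotational slice `Ω(t) = 0` (where the skeleton's averages are junk `0`) is handled
  inside the class: `∫|ω(t)|² = 0` forces `ω(t) ≡ 0` (continuity), hence zero stretching.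
* `step3_inference_holds : Step3_inference` — the bookkeeping «3c + 3d ⇒ Ω ≤ Ω_max on [0,T)»: the Riccati
  display feeds the (disputed, hypothetical) boundedness inference 3d with `k = C′(1−δ₀/2)⁴/ν³ + 1`,
  `Ω₀ = Ω(0)`.

After these (and the skeleton's own `step2_L51Abs_a_holds`, `exists_isTopEigvec`, `claimedUniqueness_holds`,
`clay_of_claimed`) the undischarged binders of `claim_of_steps'` are exactly `Step1_Thm32`, `Step12_glue`,
`Step2_L51`, `Step3b_Lambda1Estimate`, `Step3d_BoundedFromRiccati`, `Step4_GeometricBound` — the disputed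
ones. TRUE mathematics only; salvage seat `ns-claims-salvage-p5` g4. Solo lane (no item).

WHAT THIS IS NOT: not a claim about NS regularity or blow-up; not a claim about any author beyond the typed
locator.
-/

-- lint debt (one line): the Theorems namespace repeats the summit name by the D-0017 layout.
set_option linter.dupNamespace false

noncomputable section

open Set Filter MeasureTheory Topology
open scoped ENNReal NNReal ContDiff RealInnerProductSpace

namespace Summit.NavierStokesRegularity.NavierStokesRegularity.Theorems.Fulber2026Salvage

open Literature.Analysis.FluidPDE
open Literature.Claims.NS.Chae2007 (IsLocalSolution BlowsUpAt)
open Literature.Claims.NS.Permana2026 (enstrophy gradVortSq supVort stretch)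
open Literature.Claims.NS.Fulber2026
open Summit.NavierStokesRegularity.NavierStokesRegularity.Theorems.Permana2026Salvage
  (step_4_holds step_9_holds)

/-! ## Step 3a and Step 5: by name from the tree -/

/-- **Step 3a holds** — the enstrophy identity «dΩ/dt = 2Ω⟨σ⟩_Ω − ν‖∇ω‖²_{L²}» (p. 3), typed by the skeleton
as `Permana2026.Step_4` and discharged in the tree by `Permana2026Salvage.step_4_holds` (one-line alias).
[cite: Fulber2026, §V Step 2→3 p.3] [cite: MajdaBertozziCUP2002, §3.1.1 p. 87–88] -/
theorem step3a_holds : Step3a_EnstrophyEq := step_4_holds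

/-- **Step 5 holds (Beale–Kato–Majda as used, p. 3)**: a class solution on `[0,T)` whose `sup_x |ω|` is
bounded on `[0,T)` does not blow up at `T` — the constant majorant makes the BKM integral over `(0,T)` finite
(`Permana2026Salvage.step_9_holds`) and the BKM a-priori estimate bounds `Σ_{n≤3}∫‖Dⁿu(t)‖²` on `[0,T)`
(`MajdaBertozzi2002_bkmAprioriH3_holds`). [cite: Fulber2026, §V Step 4→6 p.3]
[cite: MajdaBertozzi2002, proof of Thm. 3.6 pp. 116–117] -/
theorem step5_BKM_holds : Step5_BKM := by
  intro ν T hν hT v₀ u p hsol hM hblow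
  obtain ⟨M, hM⟩ := hM
  have hBKM : (∫⁻ t in Ioo 0 T, ⨆ x, ‖curl (u t) x‖ₑ) < ⊤ :=
    step_9_holds ν hν T hT v₀ u p hsol (fun _ => M) continuousOn_const hM
  exact hblow (MajdaBertozzi2002_bkmAprioriH3_holds hν.le hT hsol.isClassical hsol.sobolev hBKM)

/-! ## Step 3c as derived in print: Young's inequality -/

/-- **Young's inequality in polynomial form** («Optimizing over ‖∇ω‖», p. 3): for `ν > 0`, `A, s ≥ 0`,
`A s³ − ν s⁴ ≤ 27A⁴/(256ν³)`, because `256ν⁴s⁴ − 256Aν³s³ + 27A⁴ = (4νs − 3A)²(16ν²s² + 8Aνs + 3A²) ≥ 0`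
(equality at `s = 3A/(4ν)`). [cite: Fulber2026, §V Step 2→3 p.3] -/
theorem young_cubic_quartic {ν A s : ℝ} (hν : 0 < ν) (hA : 0 ≤ A) (hs : 0 ≤ s) :
    A * s ^ 3 - ν * s ^ 4 ≤ 27 * A ^ 4 / (256 * ν ^ 3) := by
  rw [le_div_iff₀ (by positivity)]
  have hq : 0 ≤ 16 * ν ^ 2 * s ^ 2 + 8 * A * ν * s + 3 * A ^ 2 := by positivity
  nlinarith [mul_nonneg (sq_nonneg (4 * ν * s - 3 * A)) hq]

/-- **The real-number core of «3a + 3b ⇒ 3c»** (p. 3): with `E = ‖ω‖₂² > 0`, `Ω = E/2`, `G = ‖∇ω‖₂²`,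
`S = ∫⟪ω,(∇u)ω⟫`, `L = ⟨λ₁⟩_Ω`, the reduced stretching `S/E ≤ θL` and the «standard estimate»
`L ≤ C G^{3/4}/Ω^{1/2}` give `dΩ/dt = (−2νG + 2S)/2 ≤ (27C⁴/16) θ⁴ Ω²/ν³` (Young with `A = 2θC Ω^{1/2}`,
`s = G^{1/4}`). [cite: Fulber2026, §V Step 2→3 p.3] -/
theorem riccati_core {ν θ C E G S L : ℝ} (hν : 0 < ν) (hθ : 0 ≤ θ) (hC : 0 ≤ C) (hE : 0 < E)
    (hG : 0 ≤ G) (hred : S / E ≤ θ * L)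
    (hlam : L ≤ C * G ^ ((3:ℝ) / 4) / (E / 2) ^ ((1:ℝ) / 2)) :
    (-(2 * ν * G) + 2 * S) / 2 ≤ 27 * C ^ 4 / 16 * θ ^ 4 * (E / 2) ^ 2 / ν ^ 3 := by
  have hν' : ν ≠ 0 := hν.ne'
  have hΩ : 0 < E / 2 := by positivity
  set r := Real.sqrt (E / 2) with hr
  have hr0 : 0 < r := Real.sqrt_pos.2 hΩ
  have hr2 : r ^ 2 = E / 2 := Real.sq_sqrt hΩ.le
  have hrpow : (E / 2) ^ ((1:ℝ) / 2) = r := by rw [hr, Real.sqrt_eq_rpow]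
  set s := G ^ ((1:ℝ) / 4) with hs
  have hs0 : 0 ≤ s := Real.rpow_nonneg hG _
  have hs4 : s ^ 4 = G := by
    rw [hs, ← Real.rpow_natCast, ← Real.rpow_mul hG]; norm_num
  have hs3 : G ^ ((3:ℝ) / 4) = s ^ 3 := by
    rw [hs, ← Real.rpow_natCast, ← Real.rpow_mul hG]; norm_num
  -- `S ≤ 2 r θ C s³`
  rw [hrpow, hs3] at hlam
  have h1 : S / E ≤ θ * (C * s ^ 3 / r) := hred.trans (mul_le_mul_of_nonneg_left hlam hθ)
  have hE' : E = 2 * r ^ 2 := by linarith [hr2]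
  have h2 : S ≤ 2 * r * θ * C * s ^ 3 := by
    rw [div_le_iff₀ hE] at h1
    calc S ≤ θ * (C * s ^ 3 / r) * E := h1
      _ = 2 * r * θ * C * s ^ 3 := by rw [hE']; field_simp
  -- Young
  have hA : 0 ≤ 2 * r * θ * C := by positivity
  have hy := young_cubic_quartic hν hA hs0
  have hΩ2 : (E / 2) ^ 2 = r ^ 4 := by rw [← hr2]; ring
  rw [hΩ2]
  calc (-(2 * ν * G) + 2 * S) / 2 = S - ν * s ^ 4 := by rw [hs4]; ring
    _ ≤ 2 * r * θ * C * s ^ 3 - ν * s ^ 4 := by linarith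
    _ ≤ 27 * (2 * r * θ * C) ^ 4 / (256 * ν ^ 3) := hy
    _ = 27 * C ^ 4 / 16 * θ ^ 4 * r ^ 4 / ν ^ 3 := by field_simp; ring

/-! ## The irrotational slice inside the class -/

/-- In the class, every spatial Sobolev norm of a slice `u(t)`, `t ∈ [0,T)`, is finite. [folklore] -/
theorem lintegral_iteratedFDeriv_sq_lt_top {ν T : ℝ} {v₀ : EuclideanSpace ℝ (Fin 3) → EuclideanSpace ℝ (Fin 3)}
    {u : ℝ → EuclideanSpace ℝ (Fin 3) → EuclideanSpace ℝ (Fin 3)} {p : ℝ → EuclideanSpace ℝ (Fin 3) → ℝ}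
    (hsol : IsLocalSolution ν T v₀ u p) {t : ℝ} (ht : t ∈ Ico 0 T) (n : ℕ) :
    ∫⁻ x, ‖iteratedFDeriv ℝ n (u t) x‖ₑ ^ 2 < ⊤ := by
  obtain ⟨C, hC⟩ := hsol.sobolev t ht.2 n
  exact (hC t ⟨ht.1, le_rfl⟩).trans_lt ENNReal.coe_lt_top

/-- In the class, the enstrophy integral `∫⁻ ‖ω(t)‖ₑ²` of a slice is finite (so the skeleton's real-valued
`enstrophy` meets no junk value). [folklore] -/
theorem lintegral_curl_sq_lt_top {ν T : ℝ} {v₀ : EuclideanSpace ℝ (Fin 3) → EuclideanSpace ℝ (Fin 3)}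
    {u : ℝ → EuclideanSpace ℝ (Fin 3) → EuclideanSpace ℝ (Fin 3)} {p : ℝ → EuclideanSpace ℝ (Fin 3) → ℝ}
    (hsol : IsLocalSolution ν T v₀ u p) {t : ℝ} (ht : t ∈ Ico 0 T) :
    ∫⁻ x, ‖curl (u t) x‖ₑ ^ 2 < ⊤ := by
  have hsm : ContDiff ℝ ∞ (u t) := hsol.isClassical.contDiff_velocity ht
  have h := Wei2016.lintegral_sq_iteratedFDeriv_curl_lt_top hsm (lintegral_iteratedFDeriv_sq_lt_top hsol ht) 0
  refine lt_of_le_of_lt (le_of_eq (lintegral_congr fun x => ?_)) h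
  rw [← ofReal_norm, ← ofReal_norm, norm_iteratedFDeriv_zero]

/-- **An irrotational slice**: in the class, `‖ω(t)‖₂² = 0` forces `ω(t) ≡ 0` (the integrand is continuous
and the integral finite). [folklore] -/
theorem curl_eq_zero_of_enstrophy_eq_zero {ν T : ℝ}
    {v₀ : EuclideanSpace ℝ (Fin 3) → EuclideanSpace ℝ (Fin 3)}
    {u : ℝ → EuclideanSpace ℝ (Fin 3) → EuclideanSpace ℝ (Fin 3)} {p : ℝ → EuclideanSpace ℝ (Fin 3) → ℝ}
    (hsol : IsLocalSolution ν T v₀ u p) {t : ℝ} (ht : t ∈ Ico 0 T) (hE : enstrophy u t = 0) :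
    curl (u t) = 0 := by
  have hsm : ContDiff ℝ ∞ (u t) := hsol.isClassical.contDiff_velocity ht
  have hcont : Continuous (curl (u t)) := continuous_curl (hsm.of_le (by exact_mod_cast le_top))
  have hzero : ∫⁻ x, ‖curl (u t) x‖ₑ ^ 2 = 0 := by
    have h := (ENNReal.toReal_eq_zero_iff _).1 hE
    exact h.resolve_right (lintegral_curl_sq_lt_top hsol ht).ne
  have hae : (fun x => ‖curl (u t) x‖ₑ ^ 2) =ᵐ[volume] 0 :=
    (lintegral_eq_zero_iff' (hcont.measurable.enorm.pow_const 2).aemeasurable).1 hzero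
  have hae' : curl (u t) =ᵐ[volume] (fun _ => (0 : EuclideanSpace ℝ (Fin 3))) := by
    filter_upwards [hae] with x hx
    simpa [pow_eq_zero_iff, enorm_eq_zero] using hx
  exact (hcont.ae_eq_iff_eq volume continuous_const).1 hae'

/-- On an irrotational slice the vortex-stretching integral vanishes. [folklore] -/
theorem stretch_eq_zero_of_enstrophy_eq_zero {ν T : ℝ}
    {v₀ : EuclideanSpace ℝ (Fin 3) → EuclideanSpace ℝ (Fin 3)}
    {u : ℝ → EuclideanSpace ℝ (Fin 3) → EuclideanSpace ℝ (Fin 3)} {p : ℝ → EuclideanSpace ℝ (Fin 3) → ℝ}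
    (hsol : IsLocalSolution ν T v₀ u p) {t : ℝ} (ht : t ∈ Ico 0 T) (hE : enstrophy u t = 0) :
    stretch u t = 0 := by
  have h := curl_eq_zero_of_enstrophy_eq_zero hsol ht hE
  simp [Literature.Claims.NS.Permana2026.stretch, h]

/-! ## Step 3c_inference and Step 3_inference -/

/-- **`Step3c_inference` holds** (p. 3, «Using Lemma 5.1 and the standard estimate … Optimizing over ‖∇ω‖»):
GIVEN the enstrophy identity (3a) and the «standard estimate» (3b — a hypothesis here, disputed in the cell and
never asserted), every class solution whose stretching is reduced as in Lemma 5.1's conclusion obeys the Riccati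
display (3c) with `C′ = 27C⁴/16`, `C` the constant of 3b. The irrotational slice is treated separately
(`stretch_eq_zero_of_enstrophy_eq_zero`). [cite: Fulber2026, §V Step 2→3 p.3] -/
theorem step3c_inference_holds : Step3c_inference := by
  intro h3a h3b ν δ₀ hν hδ0 hδ1
  obtain ⟨C, hC0, hC⟩ := h3b ν hν
  refine ⟨27 * C ^ 4 / 16, by positivity, ?_⟩
  intro T hT v₀ u p hsol hred t ht
  obtain ⟨-, hder⟩ := h3a ν hν T hT v₀ u p hsol
  have hD : HasDerivWithinAt (Ens u) ((-(2 * ν * gradVortSq u t) + 2 * stretch u t) / 2) (Ici t) t :=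
    (hder t ht).div_const 2
  refine ⟨_, hD, ?_⟩
  have hE0 : 0 ≤ enstrophy u t := ENNReal.toReal_nonneg
  have hG0 : 0 ≤ gradVortSq u t := ENNReal.toReal_nonneg
  have hθ0 : 0 ≤ 1 - δ₀ / 2 := by linarith
  rcases hE0.eq_or_lt with hE | hEpos
  · -- irrotational slice: `Ω(t) = 0`, zero stretching, `dΩ/dt = −ν‖∇ω‖² ≤ 0`
    have hS : stretch u t = 0 := stretch_eq_zero_of_enstrophy_eq_zero hsol ht hE.symm
    have hΩ : Ens u t = 0 := by show enstrophy u t / 2 = 0; rw [← hE]; simp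
    rw [hS, hΩ]
    have hνG : 0 ≤ ν * gradVortSq u t := mul_nonneg hν.le hG0
    have : (-(2 * ν * gradVortSq u t) + 2 * 0) / 2 = -(ν * gradVortSq u t) := by ring
    rw [this]
    simp only [ne_eq, OfNat.ofNat_ne_zero, not_false_eq_true, zero_pow, mul_zero, zero_div]
    linarith
  · -- `Ω(t) > 0`: the real-number core
    have h1 : stretch u t / enstrophy u t ≤ (1 - δ₀ / 2) * lam1Avg u t := hred t ht
    have h2 : lam1Avg u t ≤ C * gradVortSq u t ^ ((3:ℝ) / 4) / (enstrophy u t / 2) ^ ((1:ℝ) / 2) :=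
      hC T hT v₀ u p hsol t ht
    exact riccati_core hν hθ0 hC0 hEpos hG0 h1 h2

/-- **`Step3_inference` holds** (FIG. 2 «STEP 3: Enstrophy Control»; p. 3): GIVEN the Riccati display (3c)
and the boundedness inference (3d — a hypothesis here, disputed in the cell and never asserted), a class
solution with reduced stretching at every time has `Ω ≤ Ω_max` on `[0,T)`: 3c supplies the right derivatives,
`Ω ≥ 0`, and `dΩ/dt ≤ kΩ²` with `k = C′(1−δ₀/2)⁴/ν³ + 1 > 0`. Bookkeeping only.
[cite: Fulber2026, §V Step 2→3 p.3; FIG. 2 p.2] -/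
theorem step3_inference_holds : Step3_inference := by
  intro h3c h3d ν δ₀ T hν hδ0 hδ1 hT v₀ u p hsol hred
  obtain ⟨C', hC'0, hC'⟩ := h3c ν δ₀ hν hδ0 hδ1
  have hric := hC' T hT v₀ u p hsol hred
  set k : ℝ := C' * (1 - δ₀ / 2) ^ 4 / ν ^ 3 + 1 with hk
  have hk1 : 0 ≤ C' * (1 - δ₀ / 2) ^ 4 / ν ^ 3 := by positivity
  have hk0 : 0 < k := by linarith
  have hΩ0 : ∀ s, 0 ≤ Ens u s := fun s => by
    show 0 ≤ enstrophy u s / 2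
    exact div_nonneg ENNReal.toReal_nonneg (by norm_num)
  obtain ⟨Ωmax, hΩmax⟩ := h3d k (Ens u 0) hk0 (hΩ0 0)
  classical
  let D : ℝ → ℝ := fun s => if hs : s ∈ Ico 0 T then Classical.choose (hric s hs) else 0
  refine ⟨Ωmax, hΩmax T hT (Ens u) D rfl (fun s _ => hΩ0 s) ?_⟩
  intro s hs
  have hspec := Classical.choose_spec (hric s hs)
  have hDs : D s = Classical.choose (hric s hs) := dif_pos hs
  rw [hDs]
  refine ⟨hspec.1, hspec.2.trans ?_⟩
  have h2 : 0 ≤ Ens u s ^ 2 := sq_nonneg _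
  have : C' * (1 - δ₀ / 2) ^ 4 * Ens u s ^ 2 / ν ^ 3 = (C' * (1 - δ₀ / 2) ^ 4 / ν ^ 3) * Ens u s ^ 2 := by
    ring
  rw [this, hk]
  nlinarith

end Summit.NavierStokesRegularity.NavierStokesRegularity.Theorems.Fulber2026Salvage

end

-- WHAT THIS IS NOT: not a claim about NS regularity or blow-up; not a claim about any author beyond the
-- typed locator.
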